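import Mathlib
import Literature.Geometry.Lorentzian.KerrConvergence
import Literature.Geometry.Lorentzian.KerrSchild
import Summits.FinalStateConjecture.FinalStateConjecture.Theorems.StarvedNecksFutureOrientedOfSeamedStubRay
import Summits.FinalStateConjecture.FinalStateConjecture.Theorems.EIHFluxBalanceInertialRecessionStubWindowChargesPointwise

/-!
# Route StarvedNecks — crux `GapDecaySuffices` (stmt-FinalStateConjecture-18060), line `Sketch`:
# outward rays and the seed-sphere bundle (location bricks for S4′ `stub_seededLocation`)

Def-free topological bricks consumed by the reduction of the registered stub `stub_seededLocation`
(S4′, `AnchoredV2.SeededLocation`) to its isolated inputs (worker file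
`work/stubs/StubSeededLocation.lean`, lead c1 wave 1):

* `exists_ray_constLabTime_out` — OUTWARD constant-lab-time rays on a boosted Kerr background: every
  coordinate point of positive rest-frame Kerr–Schild radius `r(y) ≤ R` lies on a preconnected
  coordinate set of constant lab time `x⁰` on which the radius stays in `[r(y), R]` and which reaches
  the sphere `{r = R}` (companion of the inward `exists_ray_constLabTime`, p144058; unboundedness of the
  radius along the ray from `sq_norm_sub_sq_le_radius_ray_sq`).
* `radius_ofTimeSpace_spheroid`, `exists_spheroid_eq` — the Kerr–Schild sphere `{r = R}`, `R > 0`, of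
  a slice is EXACTLY the confocal spheroid `(√(R² + a²) u₁, √(R² + a²) u₂, R u₃)`, `‖u‖ = 1`.
* `isPreconnected_seedSpheres` — for a continuous radius profile `R`, positive after `T`, the
  seed-sphere bundle `{z | T ≤ z⁰, rᵢ z = R(z⁰)}` of a boosted Kerr background with orthochronous motion
  is preconnected (continuous image of `[T, ∞) × S²`); it is the connected carrier of the clopen
  continuation (`flat_entry_gapTube`, p143739) seeding every late seed sphere from ONE anchored seed.

Mathlib + `Literature.Geometry.Lorentzian.KerrConvergence` / `KerrSchild` + the landed ray helpers of
`…FutureOrientedOfSeamedStubRay` (`radius_ray_monotone`, `radius_ofTimeSpace_zero_right`,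
`sq_norm_sub_sq_le_radius_ray_sq`) and `…WindowCharges.ofTimeSpace_eq_smul_add_ofTimeSpace_zero`;
no definitions, no named facts.  References: O'Neill, *The geometry
of Kerr black holes* (1995), Ch. 2, §2.1 (Kerr–Schild coordinates, confocal spheroids); O'Neill 1983,
Ch. 9 (Lorentz kinematics); Mathlib `isPreconnected_sphere`.
-/

noncomputable section

open scoped Manifold ContDiff Topology ENNReal
open Filter Set Topology Literature.Geometry.Lorentzian

namespace Summit.FinalStateConjecture.FinalStateConjecture.Theorems.GapDecaySuffices.Location

-- the route namespace repeats the summit name (`FinalStateConjecture.FinalStateConjecture`)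
set_option linter.dupNamespace false

open Summit.FinalStateConjecture.FinalStateConjecture.Theorems.FutureOrientedOfSeamed.ClockDualityRays
  (radius_ray_monotone radius_ofTimeSpace_zero_right sq_norm_sub_sq_le_radius_ray_sq)
open Summit.FinalStateConjecture.FinalStateConjecture.Theorems.SublinearIsFree.WindowCharges
  (ofTimeSpace_eq_smul_add_ofTimeSpace_zero)

/-! ## Outward constant-lab-time rays -/

/-- `(0, σ y) = σ (0, y)`. [folklore] -/
theorem ofTimeSpace_zero_smul (σ : ℝ) (y : E3) :
    E4.ofTimeSpace 0 (σ • y) = σ • E4.ofTimeSpace 0 y := by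
  ext i
  refine Fin.cases ?_ (fun j => ?_) i
  · simp
  · simp

/-- The Kerr–Schild radius of `(t, y)` does not depend on the time `t`. [folklore] -/
theorem radius_ofTimeSpace_time_indep (a t t' : ℝ) (y : E3) :
    Kerr.radius a (E4.ofTimeSpace t y) = Kerr.radius a (E4.ofTimeSpace t' y) := by
  have h3 : E4.ofTimeSpace t y 3 = y 2 := by
    have h := E4.ofTimeSpace_apply_succ t y 2
    simpa using h
  have h3' : E4.ofTimeSpace t' y 3 = y 2 := by
    have h := E4.ofTimeSpace_apply_succ t' y 2
    simpa using h
  unfold Kerr.radius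
  rw [E4.spatialNorm_ofTimeSpace, E4.spatialNorm_ofTimeSpace, h3, h3']

/-- **Outward constant-lab-time rays.**  On a boosted Kerr background with orthochronous motion
`(Λ, c)` (`(Λe₀)⁰ > 0`), every coordinate point `y` of positive rest-frame Kerr–Schild radius
`r(y) ≤ R` lies on a preconnected coordinate set `S` of CONSTANT lab time `z⁰ = y⁰` on which the
radius stays in `[r(y), R]` and which contains a point of radius exactly `R`: the boosted image of the
rest-frame path `σ ↦ (τ + (1 − σ)ℓ/γ, σξ)`, `σ ≥ 1`, along which lab time is constant and the radius is
that of `(·, σξ)` — monotone (`radius_ray_monotone`) and unbounded (`sq_norm_sub_sq_le_radius_ray_sq`) —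
cut at `r = R` by the intermediate value theorem.  O'Neill 1995, Ch. 2, §2.1. [folklore] -/
theorem exists_ray_constLabTime_out (Λ : lorentzGroup) (c : E4) (M a : ℝ)
    (hv : 0 < ((Λ : E4 ≃L[ℝ] E4) (E4.basisVector 0)) 0) (y : E4) {R : ℝ}
    (hy : 0 < (boostedKerrBackground Λ c M a).radius y)
    (hyR : (boostedKerrBackground Λ c M a).radius y ≤ R) :
    ∃ S : Set E4, IsPreconnected S ∧ y ∈ S ∧
      (∀ z ∈ S, z 0 = y 0 ∧ (boostedKerrBackground Λ c M a).radius y ≤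
          (boostedKerrBackground Λ c M a).radius z ∧
        (boostedKerrBackground Λ c M a).radius z ≤ R) ∧
      ∃ z ∈ S, (boostedKerrBackground Λ c M a).radius z = R := by
  -- notation
  set L : E4 ≃L[ℝ] E4 := (Λ : E4 ≃L[ℝ] E4) with hLdef
  set e₀ : E4 := E4.basisVector 0 with he₀
  set v0 : ℝ := L e₀ 0 with hv0def
  have hv0 : 0 < v0 := hv
  set x' : E4 := poincareInv Λ c y with hx'def
  set τ : ℝ := x' 0 with hτdef
  set ξ : E3 := E4.spatial x' with hξdef
  have hx' : x' = E4.ofTimeSpace τ ξ := (E4.ofTimeSpace_time_spatial x').symm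
  set ζ : E4 := E4.ofTimeSpace 0 ξ with hζdef
  set ℓ : ℝ := L ζ 0 with hℓdef
  set m : ℝ := ℓ / v0 with hmdef
  have hmv : m * v0 = ℓ := div_mul_cancel₀ _ hv0.ne'
  -- the rest-frame path, its boosted image, and the radius along the ray
  let p : ℝ → E4 := fun σ ↦ (τ + (1 - σ) * m) • e₀ + σ • ζ
  let γ : ℝ → E4 := fun σ ↦ L (p σ) + c
  let f : ℝ → ℝ := fun σ ↦ Kerr.radius a (E4.ofTimeSpace τ (σ • ξ))
  have hp : ∀ σ, p σ = E4.ofTimeSpace (τ + (1 - σ) * m) (σ • ξ) := by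
    intro σ
    rw [ofTimeSpace_eq_smul_add_ofTimeSpace_zero, ofTimeSpace_zero_smul]
  have hγinv : ∀ σ, poincareInv Λ c (γ σ) = p σ := by
    intro σ
    simp only [γ, poincareInv, add_sub_cancel_right, hLdef, ContinuousLinearEquiv.symm_apply_apply]
  have hp1 : p 1 = x' := by
    rw [hp, hx', sub_self, zero_mul, add_zero, one_smul]
  have hγ1 : γ 1 = y := by
    have h : L (poincareInv Λ c y) + c = y := by
      simp only [poincareInv, hLdef, ContinuousLinearEquiv.apply_symm_apply, sub_add_cancel]
    show L (p 1) + c = y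
    rw [hp1]
    exact h
  have hpc : Continuous p := by
    show Continuous fun σ : ℝ ↦ (τ + (1 - σ) * m) • e₀ + σ • ζ
    fun_prop
  have hγc : Continuous γ := (L.continuous.comp hpc).add continuous_const
  have hfc : Continuous f :=
    (Kerr.continuous_radius a).comp
      ((E4.continuous_ofTimeSpace τ).comp (continuous_id.smul continuous_const))
  have hf1 : f 1 = Kerr.radius a x' := by
    show Kerr.radius a (E4.ofTimeSpace τ ((1 : ℝ) • ξ)) = _
    rw [one_smul, hx']
  have hrad : ∀ σ, Kerr.radius a (poincareInv Λ c (γ σ)) = f σ := by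
    intro σ
    rw [hγinv, hp]
    exact radius_ofTimeSpace_time_indep a _ τ _
  have hry : (boostedKerrBackground Λ c M a).radius y = f 1 := by
    rw [hf1]; rfl
  -- lab time is constant along the path
  have hlab : ∀ σ, γ σ 0 = (τ + (1 - σ) * m) * v0 + σ * ℓ + c 0 := by
    intro σ
    show (L ((τ + (1 - σ) * m) • e₀ + σ • ζ) + c) 0 = _
    rw [map_add, map_smul, map_smul]
    rfl
  have hy0 : y 0 = τ * v0 + ℓ + c 0 := by
    have h := hlab 1
    rw [hγ1] at h
    rw [h]
    ring
  have hlab_eq : ∀ σ, γ σ 0 = y 0 := by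
    intro σ
    rw [hlab, hy0]
    have h : (1 - σ) * m * v0 = (1 - σ) * ℓ := by rw [mul_assoc, hmv]
    linear_combination h
  -- the ray is unbounded: `ξ ≠ 0` and `f σ₁ ≥ R` for `σ₁ ‖ξ‖ ≥ R + |a|`
  have hξ : 0 < ‖ξ‖ := by
    by_contra h0
    have hξ0 : ξ = 0 := by
      have : ‖ξ‖ = 0 := le_antisymm (not_lt.1 h0) (norm_nonneg _)
      exact norm_eq_zero.1 this
    have : f 1 = 0 := by
      show Kerr.radius a (E4.ofTimeSpace τ ((1 : ℝ) • ξ)) = 0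
      rw [hξ0, smul_zero]
      exact radius_ofTimeSpace_zero_right a τ
    rw [hry, this] at hy
    exact lt_irrefl _ hy
  have hR0 : 0 ≤ R := (le_of_lt hy).trans hyR
  set σ₁ : ℝ := max 1 ((R + |a|) / ‖ξ‖) with hσ₁
  have hσ₁1 : 1 ≤ σ₁ := le_max_left _ _
  have hfσ₁ : R ≤ f σ₁ := by
    have h1 : R + |a| ≤ σ₁ * ‖ξ‖ := by
      have : (R + |a|) / ‖ξ‖ ≤ σ₁ := le_max_right _ _
      rwa [div_le_iff₀ hξ] at this
    have h2 : (σ₁ * ‖ξ‖) ^ 2 - a ^ 2 ≤ f σ₁ ^ 2 := sq_norm_sub_sq_le_radius_ray_sq a τ ξ σ₁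
    have h3 : R ^ 2 ≤ f σ₁ ^ 2 := by
      have ha : 0 ≤ |a| := abs_nonneg a
      have : R ^ 2 ≤ (σ₁ * ‖ξ‖) ^ 2 - a ^ 2 := by
        rw [← sq_abs a]; nlinarith
      linarith
    exact (abs_le_of_sq_le_sq' h3 (Kerr.radius_nonneg _ _)).2
  -- cut the ray at `r = R`
  obtain ⟨σ₀, hσ₀, hfσ₀⟩ : ∃ σ₀ ∈ Icc (1 : ℝ) σ₁, f σ₀ = R :=
    intermediate_value_Icc hσ₁1 hfc.continuousOn ⟨by rw [← hry]; exact hyR, hfσ₁⟩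
  have hseg : ∀ σ ∈ Icc 1 σ₀, f 1 ≤ f σ ∧ f σ ≤ R := by
    intro σ hσ
    have hlo : f 1 ≤ f σ := radius_ray_monotone a τ ξ zero_le_one hσ.1
    have hhi : f σ ≤ f σ₀ := radius_ray_monotone a τ ξ (zero_le_one.trans hσ.1) hσ.2
    rw [hfσ₀] at hhi
    exact ⟨hlo, hhi⟩
  refine ⟨γ '' Icc 1 σ₀, isPreconnected_Icc.image γ hγc.continuousOn,
    ⟨1, left_mem_Icc.mpr hσ₀.1, hγ1⟩, ?_, ⟨γ σ₀, ⟨σ₀, right_mem_Icc.mpr hσ₀.1, rfl⟩, ?_⟩⟩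
  · rintro _ ⟨σ, hσ, rfl⟩
    refine ⟨hlab_eq σ, ?_, ?_⟩
    · show Kerr.radius a (poincareInv Λ c y) ≤ Kerr.radius a (poincareInv Λ c (γ σ))
      rw [hrad, ← hf1]
      exact (hseg σ hσ).1
    · show Kerr.radius a (poincareInv Λ c (γ σ)) ≤ R
      rw [hrad]
      exact (hseg σ hσ).2
  · show Kerr.radius a (poincareInv Λ c (γ σ₀)) = R
    rw [hrad]
    exact hfσ₀

/-! ## The Kerr–Schild spheres are confocal spheroids -/

/-- **The confocal spheroid lies on the Kerr–Schild sphere**: for `‖u‖ = 1`, `R ≥ 0`, the point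
`(√(R² + a²) u₁, √(R² + a²) u₂, R u₃)` of a slice `{t = const}` has Kerr–Schild radius exactly `R`
(`ρ² − a² = R² − a²u₃²` and the discriminant is `(R² + a²u₃²)²`).  O'Neill 1995, Ch. 2, §2.1.
[folklore] -/
theorem radius_ofTimeSpace_spheroid (a R t : ℝ) (u : E3) (hR : 0 ≤ R) (hu : ‖u‖ = 1) :
    Kerr.radius a (E4.ofTimeSpace t
      (WithLp.toLp 2 ![√(R ^ 2 + a ^ 2) * u 0, √(R ^ 2 + a ^ 2) * u 1, R * u 2])) = R := by
  set v : E3 := WithLp.toLp 2 ![√(R ^ 2 + a ^ 2) * u 0, √(R ^ 2 + a ^ 2) * u 1, R * u 2] with hv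
  set x : E4 := E4.ofTimeSpace t v with hx
  have hq : √(R ^ 2 + a ^ 2) ^ 2 = R ^ 2 + a ^ 2 := Real.sq_sqrt (by positivity)
  have hu' : u 0 ^ 2 + u 1 ^ 2 + u 2 ^ 2 = 1 := by
    have h := EuclideanSpace.real_norm_sq_eq u
    rw [hu, Fin.sum_univ_three] at h
    linarith
  have hn : E4.spatialNorm x ^ 2 = R ^ 2 + a ^ 2 - a ^ 2 * u 2 ^ 2 := by
    rw [hx, E4.spatialNorm_ofTimeSpace, EuclideanSpace.real_norm_sq_eq, Fin.sum_univ_three]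
    simp only [hv, PiLp.toLp_apply, Matrix.cons_val_zero, Matrix.cons_val_one, Matrix.cons_val]
    nlinarith [hq, hu']
  have h3 : x 3 = R * u 2 := by
    have h := E4.ofTimeSpace_apply_succ t v 2
    simpa [hv] using h
  have hdisc : √((E4.spatialNorm x ^ 2 - a ^ 2) ^ 2 + 4 * a ^ 2 * x 3 ^ 2) =
      R ^ 2 + a ^ 2 * u 2 ^ 2 := by
    rw [hn, h3, show (R ^ 2 + a ^ 2 - a ^ 2 * u 2 ^ 2 - a ^ 2) ^ 2 + 4 * a ^ 2 * (R * u 2) ^ 2 =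
      (R ^ 2 + a ^ 2 * u 2 ^ 2) ^ 2 by ring]
    exact Real.sqrt_sq (by positivity)
  have hsq : Kerr.radius a x ^ 2 = R ^ 2 := by
    rw [Kerr.radius_sq, hdisc, hn]
    ring
  exact (pow_left_inj₀ (Kerr.radius_nonneg a x) hR two_ne_zero).1 hsq

/-- **Every point of the Kerr–Schild sphere `{r = R}`, `R > 0`, is a confocal-spheroid point**:
`y = (√(R² + a²) u₁, √(R² + a²) u₂, R u₃)` with `‖u‖ = 1` (the defining quartic
`R⁴ − (ρ² − a²)R² − a²y₃² = 0` is the spheroid equation `(y₁² + y₂²)/(R² + a²) + y₃²/R² = 1`).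
O'Neill 1995, Ch. 2, §2.1. [folklore] -/
theorem exists_spheroid_eq (a R t : ℝ) (y : E3) (hR : 0 < R)
    (hy : Kerr.radius a (E4.ofTimeSpace t y) = R) :
    ∃ u : E3, ‖u‖ = 1 ∧
      WithLp.toLp 2 ![√(R ^ 2 + a ^ 2) * u 0, √(R ^ 2 + a ^ 2) * u 1, R * u 2] = y := by
  set q : ℝ := √(R ^ 2 + a ^ 2) with hqdef
  have hq2 : q ^ 2 = R ^ 2 + a ^ 2 := Real.sq_sqrt (by positivity)
  have hq : 0 < q := Real.sqrt_pos.2 (by positivity)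
  refine ⟨WithLp.toLp 2 ![y 0 / q, y 1 / q, y 2 / R], ?_, ?_⟩
  · -- the spheroid equation from the quartic
    have hquart := Kerr.radius_quartic a (E4.ofTimeSpace t y)
    have h3 : E4.ofTimeSpace t y 3 = y 2 := by
      have h := E4.ofTimeSpace_apply_succ t y 2
      simpa using h
    rw [hy, E4.spatialNorm_ofTimeSpace, h3, EuclideanSpace.real_norm_sq_eq, Fin.sum_univ_three]
      at hquart
    have hn : ‖(WithLp.toLp 2 ![y 0 / q, y 1 / q, y 2 / R] : E3)‖ ^ 2 = 1 := by
      rw [EuclideanSpace.real_norm_sq_eq, Fin.sum_univ_three]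
      simp only [Matrix.cons_val_zero, Matrix.cons_val_one, Matrix.cons_val]
      rw [div_pow, div_pow, div_pow, hq2]
      field_simp
      linear_combination (-1 : ℝ) * hquart
    have h0 : 0 ≤ ‖(WithLp.toLp 2 ![y 0 / q, y 1 / q, y 2 / R] : E3)‖ := norm_nonneg _
    nlinarith [hn, h0]
  · ext i
    fin_cases i <;> simp <;> field_simp

/-- **The seed-sphere bundle is preconnected.**  On a boosted Kerr background with orthochronous motion
`(Λ, c)` and for a continuous radius profile `R` positive after `T`, the coordinate set
`{z | T ≤ z⁰, r(Λ⁻¹(z − c)) = R(z⁰)}` is preconnected: it is the continuous image of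
`[T, ∞) × S²` under `(s, u) ↦ Λ(t′, spheroid(R s, u)) + c`, the rest-frame time `t′` being solved
from the lab time `s` (`(Λe₀)⁰ > 0`).  O'Neill 1995, Ch. 2, §2.1; O'Neill 1983, Ch. 9. [folklore] -/
theorem isPreconnected_seedSpheres (Λ : lorentzGroup) (c : E4) (M a : ℝ)
    (hv : 0 < ((Λ : E4 ≃L[ℝ] E4) (E4.basisVector 0)) 0) {R : ℝ → ℝ} (hRc : Continuous R)
    (T : ℝ) (hRpos : ∀ s, T ≤ s → 0 < R s) :
    IsPreconnected {z : E4 | T ≤ z 0 ∧ (boostedKerrBackground Λ c M a).radius z = R (z 0)} := by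
  -- notation
  set L : E4 ≃L[ℝ] E4 := (Λ : E4 ≃L[ℝ] E4) with hLdef
  set e₀ : E4 := E4.basisVector 0 with he₀
  set v0 : ℝ := L e₀ 0 with hv0def
  have hv0 : 0 < v0 := hv
  -- the spheroid parametrisation of the bundle
  let sph : ℝ → E3 → E3 := fun r u ↦
    WithLp.toLp 2 ![√(r ^ 2 + a ^ 2) * u 0, √(r ^ 2 + a ^ 2) * u 1, r * u 2]
  let t' : ℝ × E3 → ℝ := fun p ↦ (p.1 - c 0 - L (E4.ofTimeSpace 0 (sph (R p.1) p.2)) 0) / v0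
  let F : ℝ × E3 → E4 := fun p ↦ L (E4.ofTimeSpace (t' p) (sph (R p.1) p.2)) + c
  have hsphc : Continuous fun p : ℝ × E3 ↦ sph (R p.1) p.2 := by
    refine (PiLp.continuous_toLp 2 _).comp ?_
    refine continuous_pi fun i => ?_
    have h0 : Continuous fun p : ℝ × E3 ↦ p.2 0 := (PiLp.continuous_apply 2 _ 0).comp continuous_snd
    have h1 : Continuous fun p : ℝ × E3 ↦ p.2 1 := (PiLp.continuous_apply 2 _ 1).comp continuous_snd
    have h2 : Continuous fun p : ℝ × E3 ↦ p.2 2 := (PiLp.continuous_apply 2 _ 2).comp continuous_snd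
    have hR1 : Continuous fun p : ℝ × E3 ↦ R p.1 := hRc.comp continuous_fst
    fin_cases i
    · simpa [Pi.mul_def] using ((hR1.pow 2).add continuous_const).sqrt.mul h0
    · simpa [Pi.mul_def] using ((hR1.pow 2).add continuous_const).sqrt.mul h1
    · simpa [Pi.mul_def] using hR1.mul h2
  have hsph0c : Continuous fun p : ℝ × E3 ↦ E4.ofTimeSpace 0 (sph (R p.1) p.2) :=
    (E4.continuous_ofTimeSpace 0).comp hsphc
  have ht'c : Continuous t' := by
    show Continuous fun p : ℝ × E3 ↦ (p.1 - c 0 - L (E4.ofTimeSpace 0 (sph (R p.1) p.2)) 0) / v0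
    refine Continuous.div_const ?_ _
    exact (continuous_fst.sub continuous_const).sub
      ((PiLp.continuous_apply 2 _ 0).comp (L.continuous.comp hsph0c))
  have hFc : Continuous F := by
    show Continuous fun p : ℝ × E3 ↦ L (E4.ofTimeSpace (t' p) (sph (R p.1) p.2)) + c
    have : Continuous fun p : ℝ × E3 ↦ E4.ofTimeSpace (t' p) (sph (R p.1) p.2) := by
      have h : (fun p : ℝ × E3 ↦ E4.ofTimeSpace (t' p) (sph (R p.1) p.2)) =
          fun p ↦ t' p • e₀ + E4.ofTimeSpace 0 (sph (R p.1) p.2) := by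
        funext p; exact ofTimeSpace_eq_smul_add_ofTimeSpace_zero _ _
      rw [h]
      exact (ht'c.smul continuous_const).add hsph0c
    exact (L.continuous.comp this).add continuous_const
  -- lab time and radius of the parametrisation
  have hF0 : ∀ p : ℝ × E3, F p 0 = p.1 := by
    intro p
    show (L (E4.ofTimeSpace (t' p) (sph (R p.1) p.2)) + c) 0 = p.1
    rw [ofTimeSpace_eq_smul_add_ofTimeSpace_zero, map_add, map_smul, PiLp.add_apply, PiLp.add_apply,
      PiLp.smul_apply, smul_eq_mul]
    show t' p * v0 + _ + _ = _
    have : t' p * v0 = p.1 - c 0 - L (E4.ofTimeSpace 0 (sph (R p.1) p.2)) 0 := div_mul_cancel₀ _ hv0.ne'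
    rw [this]; ring
  have hFinv : ∀ p : ℝ × E3, poincareInv Λ c (F p) = E4.ofTimeSpace (t' p) (sph (R p.1) p.2) := by
    intro p
    simp only [F, poincareInv, add_sub_cancel_right, hLdef, ContinuousLinearEquiv.symm_apply_apply]
  -- the bundle is the image of `[T, ∞) × S²`
  have himage : F '' (Ici T ×ˢ Metric.sphere (0 : E3) 1) =
      {z : E4 | T ≤ z 0 ∧ (boostedKerrBackground Λ c M a).radius z = R (z 0)} := by
    apply Subset.antisymm
    · rintro _ ⟨p, ⟨hp1, hp2⟩, rfl⟩
      rw [mem_Ici] at hp1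
      rw [mem_sphere_zero_iff_norm] at hp2
      refine ⟨by rw [hF0]; exact hp1, ?_⟩
      show Kerr.radius a (poincareInv Λ c (F p)) = R (F p 0)
      rw [hFinv, hF0]
      exact radius_ofTimeSpace_spheroid a (R p.1) _ p.2 (hRpos p.1 hp1).le hp2
    · rintro z ⟨hzT, hzr⟩
      set x' : E4 := poincareInv Λ c z with hx'def
      set τ : ℝ := x' 0 with hτdef
      set y : E3 := E4.spatial x' with hydef
      have hx' : x' = E4.ofTimeSpace τ y := (E4.ofTimeSpace_time_spatial x').symm
      have hr : Kerr.radius a (E4.ofTimeSpace τ y) = R (z 0) := by rw [← hx']; exact hzr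
      obtain ⟨u, hu, huy⟩ := exists_spheroid_eq a (R (z 0)) τ y (hRpos _ hzT) hr
      refine ⟨(z 0, u), ⟨mem_Ici.2 hzT, mem_sphere_zero_iff_norm.2 hu⟩, ?_⟩
      have hsph : sph (R (z 0)) u = y := huy
      have hz : z = L x' + c := by
        rw [hx'def, poincareInv, hLdef, ContinuousLinearEquiv.apply_symm_apply, sub_add_cancel]
      have hz0 : z 0 = τ * v0 + L (E4.ofTimeSpace 0 y) 0 + c 0 := by
        conv_lhs => rw [hz, hx', ofTimeSpace_eq_smul_add_ofTimeSpace_zero]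
        rw [map_add, map_smul, PiLp.add_apply, PiLp.add_apply, PiLp.smul_apply, smul_eq_mul]
      have ht' : t' (z 0, u) = τ := by
        show (z 0 - c 0 - L (E4.ofTimeSpace 0 (sph (R (z 0)) u)) 0) / v0 = τ
        rw [hsph, div_eq_iff hv0.ne', hz0]
        ring
      show L (E4.ofTimeSpace (t' (z 0, u)) (sph (R (z 0)) u)) + c = z
      rw [ht', hsph, ← hx', hz]
  rw [← himage]
  have hrank : 1 < Module.rank ℝ E3 := by
    rw [← Module.finrank_eq_rank, finrank_euclideanSpace_fin]
    norm_num
  exact (isPreconnected_Ici.prod (isPreconnected_sphere hrank (0 : E3) 1)).image F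
    hFc.continuousOn

end Summit.FinalStateConjecture.FinalStateConjecture.Theorems.GapDecaySuffices.Location

end
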